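import Summits.ResolutionOfSingularities.ResolutionOfSingularities.Theorems.HomologicalConductorNoZenoH0GermTransport
import HarnessLib

/-!
# Crux `NoZenoR` (stmt-ResolutionOfSingularities-19943), slot 5 `stub_L1wCoreF3`, (B1) UP-5c (sequel):
# THE NODE CURVES STAY OF THE FIRST KIND ON THE GERM RESOLUTION

OURS (cell res-hironaka, crux chain W4.4, seat res-L0-w44-stub-1 g12; the by-signature numerical input
«first kind: stub-1 UP-5» of step (2) of the closer of slot 5, planner DESK WORD 18). Nothing here is a
statement of the manuscript under review (Hironaka 2017); AI-written, weaker than expert review. Def-free,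
fact-free, `--supports 19943 --as helper`.  Sequel of `…NoZenoH0GermTransport` (change of local base
`h0_comp_specMap`, factorization through `Spec N_𝔮`, `h0_comap_fst_localization_mul`).

Setting: `σ : V → Spec N`, `𝔮 ⊂ N` maximal, `N' = N_𝔮`, `g = Spec(N → N')`, `fst = pullback.fst σ g`,
`ψ = pullback.snd σ g : V ×_N Spec N' → Spec N'` (the germ resolution of
`…ExcCurvesLocalization.excCurvePoints_pullback_snd_localization`), `ζ` a point of `V ×_N Spec N'` whose image
`z = fst ζ` lies over `𝔮`.

* §4 `comap_primeDivisorIdeal_of_isReduced / _of_isOpenImmersion`, **`comap_fst_primeDivisorIdeal`** (+ `_pow`) —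
  `fst*𝓘_z = 𝓘_ζ`: the inverse image of the prime divisor ideal of `cl{z}` is the prime divisor ideal of `cl{ζ}`
  (`V(fst*𝓘_z) ≅ V(𝓘_z)` is integral; an embedding has `fst⁻¹ cl{z} = cl{ζ}`).
* §5 **`h0_primeDivisorIdeal_sq_eq_three_mul_of_fst`** (ring-hom form `φ : S → N`, `𝔮.comap φ = 𝔪_S`; no
  residue-field instance in the statement) — FIRST KIND IS INHERITED BY THE GERM: if
  `h0 (σ ≫ Spec φ) (𝓘_z ^ 2) = 3 * h0 (σ ≫ Spec φ) 𝓘_z` with `h0 (σ ≫ Spec φ) 𝓘_z ≠ ⊤`, then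
  `h0 ψ (𝓘_ζ ^ 2) = 3 * h0 ψ 𝓘_ζ` — the literal hypothesis of `Lipman1969_27_1_reg_rat` for `ψ`;
  **`…_of_openImmersion`** adds the step `X ⊇ U` (`…PointBlowupNode.h0_comap_of_isOpenImmersion`), so that UP-5
  (`…PointBlowupNode.h0_comap_vanishingIdeal_node` on `X¹ = Bl_{nodes} X` over `S`) feeds it directly.

References: J. Lipman, Publ. Math. IHÉS 36 (1969) §10 p. 212, §27 (27.1) [`Lipman1969`] (context); The Stacks
Project, Tag 01J3 (reduced induced structure).
-/

noncomputable section

-- single-problem summit: the doubled namespace component `ResolutionOfSingularities` is forced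
set_option linter.dupNamespace false

namespace Summit.ResolutionOfSingularities.ResolutionOfSingularities.Theorems.NoZeno.ExcCount

open CategoryTheory AlgebraicGeometry Limits TopologicalSpace Topology Opposite IsLocalRing
open Literature.AlgebraicGeometry.Morphisms Literature.AlgebraicGeometry.Resolution
open Scheme.IdealSheafData

universe u

/-! ## §4 The pulled-back curve is the reduced curve through the point over `z` -/

section Ideals

/-- **Inverse image of a prime divisor ideal along a preimmersion, when reduced.** For a preimmersion
`f : X' → X` (a topological embedding) and `ζ ∈ X'`: if the closed subscheme of `f*𝓘_{f ζ}` is reduced, then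
`f*𝓘_{f ζ} = 𝓘_ζ` (a reduced ideal sheaf is the vanishing ideal of its support, and
`f⁻¹ cl{f ζ} = cl{ζ}` for an embedding). [folklore] -/
theorem comap_primeDivisorIdeal_of_isReduced {X X' : Scheme.{u}} (f : X' ⟶ X) [IsPreimmersion f] (ζ : X')
    [IsReduced ((primeDivisorIdeal (f.base ζ)).comap f).subscheme] :
    (primeDivisorIdeal (f.base ζ)).comap f = primeDivisorIdeal ζ := by
  rw [← radical_eq_of_isReduced_subscheme ((primeDivisorIdeal (f.base ζ)).comap f),
    ← vanishingIdeal_support, support_comap]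
  unfold primeDivisorIdeal
  congr 1
  apply Closeds.ext
  change f.base ⁻¹' ((vanishingIdeal (⟨closure {f.base ζ}, isClosed_closure⟩ : Closeds X)).support : Set X) =
    closure {ζ}
  rw [coe_support_vanishingIdeal]
  change f.base ⁻¹' closure {f.base ζ} = closure {ζ}
  rw [f.isEmbedding.closure_eq_preimage_closure_image, Set.image_singleton]

/-- Along an OPEN IMMERSION the prime divisor ideal of `f ζ` pulls back to that of `ζ` (the pulled-back
subscheme is an open subscheme of the integral curve `cl{f ζ}`, hence reduced). [folklore] -/
theorem comap_primeDivisorIdeal_of_isOpenImmersion {X X' : Scheme.{u}} (f : X' ⟶ X) [IsOpenImmersion f]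
    (ζ : X') : (primeDivisorIdeal (f.base ζ)).comap f = primeDivisorIdeal ζ := by
  haveI : IsIntegral (primeDivisorIdeal (f.base ζ)).subscheme :=
    Literature.AlgebraicGeometry.Motives.isIntegral_subscheme_vanishingIdeal_closure (f.base ζ)
  haveI : IsReduced ((primeDivisorIdeal (f.base ζ)).comap f).subscheme :=
    isReduced_of_isOpenImmersion
      (((primeDivisorIdeal (f.base ζ)).comapIso f).hom ≫ pullback.snd f (primeDivisorIdeal (f.base ζ)).subschemeι)
  exact comap_primeDivisorIdeal_of_isReduced f ζ

/-- Powers: `f*(𝓘_{f ζ} ^ n) = 𝓘_ζ ^ n` along an open immersion. [folklore] -/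
theorem comap_primeDivisorIdeal_pow_of_isOpenImmersion {X X' : Scheme.{u}} (f : X' ⟶ X) [IsOpenImmersion f]
    (ζ : X') (n : ℕ) : (primeDivisorIdeal (f.base ζ) ^ n).comap f = primeDivisorIdeal ζ ^ n := by
  rw [comap_pow, comap_primeDivisorIdeal_of_isOpenImmersion]

variable {N N' : Type u} [CommRing N] [CommRing N'] [Algebra N N'] (𝔮 : Ideal N) [𝔮.IsMaximal]
  [IsLocalization.AtPrime N' 𝔮] {V : Scheme.{u}} (σ : V ⟶ Spec (.of N))

/-- **The pulled-back node curve is the reduced curve through `ζ`.** For `σ : V → Spec N`, `g = Spec(N → N_𝔮)`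
(`𝔮` maximal) and a point `ζ` of `V ×_N Spec N_𝔮` whose image `z = fst ζ` lies over `𝔮`:
`fst*𝓘_z = 𝓘_ζ` — the inverse image of the prime divisor ideal of `cl{z}` along `pullback.fst σ g` is the
prime divisor ideal of `cl{ζ}` (`V(fst*𝓘_z) ≅ V(𝓘_z)` is integral). [this work] -/
theorem comap_fst_primeDivisorIdeal
    (ζ : ↑(pullback σ (Spec.map (CommRingCat.ofHom (algebraMap N N')))))
    (hζ : σ.base ((pullback.fst σ (Spec.map (CommRingCat.ofHom (algebraMap N N')))).base ζ) =
      ⟨𝔮, inferInstance⟩) :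
    (primeDivisorIdeal ((pullback.fst σ (Spec.map (CommRingCat.ofHom (algebraMap N N')))).base ζ)).comap
        (pullback.fst σ (Spec.map (CommRingCat.ofHom (algebraMap N N')))) =
      primeDivisorIdeal ζ := by
  haveI : IsPreimmersion (Spec.map (CommRingCat.ofHom (algebraMap N N'))) :=
    IsPreimmersion.of_isLocalization 𝔮.primeCompl
  obtain ⟨τ₁, hτ₁⟩ := exists_fac_specMap_localization (N' := N') 𝔮
    ((primeDivisorIdeal ((pullback.fst σ (Spec.map (CommRingCat.ofHom (algebraMap N N')))).base
      ζ)).subschemeι ≫ σ)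
    (asIdeal_subschemeι_le 𝔮 σ _ fun v hv => base_eq_of_mem_support_primeDivisorIdeal 𝔮 σ hζ hv)
  have sq1 := isPullback_subscheme_comap σ
    (pullback.snd σ (Spec.map (CommRingCat.ofHom (algebraMap N N'))))
    (pullback.fst σ (Spec.map (CommRingCat.ofHom (algebraMap N N'))))
    (IsPullback.of_hasPullback σ (Spec.map (CommRingCat.ofHom (algebraMap N N'))))
    (primeDivisorIdeal ((pullback.fst σ (Spec.map (CommRingCat.ofHom (algebraMap N N')))).base ζ))
  have sq2 := isPullback_id_of_fac 𝔮 _ τ₁ hτ₁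
  let e := sq1.isoIsPullback _ _ sq2
  haveI : IsIntegral (primeDivisorIdeal
      ((pullback.fst σ (Spec.map (CommRingCat.ofHom (algebraMap N N')))).base ζ)).subscheme :=
    Literature.AlgebraicGeometry.Motives.isIntegral_subscheme_vanishingIdeal_closure _
  haveI : IsReduced ((primeDivisorIdeal
      ((pullback.fst σ (Spec.map (CommRingCat.ofHom (algebraMap N N')))).base ζ)).comap
        (pullback.fst σ (Spec.map (CommRingCat.ofHom (algebraMap N N'))))).subscheme :=
    isReduced_of_isOpenImmersion e.hom
  exact comap_primeDivisorIdeal_of_isReduced _ ζ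

/-- Powers: `fst*(𝓘_z ^ n) = 𝓘_ζ ^ n` (inverse image is multiplicative, tree `comap_pow`). [this work] -/
theorem comap_fst_primeDivisorIdeal_pow
    (ζ : ↑(pullback σ (Spec.map (CommRingCat.ofHom (algebraMap N N')))))
    (hζ : σ.base ((pullback.fst σ (Spec.map (CommRingCat.ofHom (algebraMap N N')))).base ζ) =
      ⟨𝔮, inferInstance⟩) (n : ℕ) :
    (primeDivisorIdeal ((pullback.fst σ (Spec.map (CommRingCat.ofHom (algebraMap N N')))).base ζ) ^ n).comap
        (pullback.fst σ (Spec.map (CommRingCat.ofHom (algebraMap N N')))) =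
      primeDivisorIdeal ζ ^ n := by
  rw [comap_pow, comap_fst_primeDivisorIdeal 𝔮 σ ζ hζ]

end Ideals

/-! ## §5 First kind is inherited by the germ resolution -/

section FirstKind

/-- Cancellation in `ℕ∞`: `a·d = 3·(b·d)` with `d ≠ 0` and `b·d` finite forces `a = 3·b`. [folklore] -/
private theorem enat_eq_three_mul {a b d : ℕ∞} (hd : d ≠ 0) (hb : b * d ≠ ⊤)
    (h : a * d = 3 * (b * d)) : a = 3 * b := by
  by_cases hb0 : b = 0
  · subst hb0
    rw [zero_mul, mul_zero, mul_eq_zero] at h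
    rcases h with h | h
    · rw [h, mul_zero]
    · exact absurd h hd
  have hdT : d ≠ ⊤ := fun hdT => hb (by rw [hdT, ENat.mul_top hb0])
  have hbT : b ≠ ⊤ := fun hbT => hb (by rw [hbT, ENat.top_mul hd])
  have h3 : (3 : ℕ∞) * (b * d) ≠ ⊤ := WithTop.mul_ne_top (ENat.coe_ne_top 3) hb
  have haT : a ≠ ⊤ := by
    intro haT
    rw [haT, ENat.top_mul hd] at h
    exact h3 h.symm
  lift a to ℕ using haT
  lift b to ℕ using hbT
  lift d to ℕ using hdT
  have hd' : 0 < d := Nat.pos_of_ne_zero fun h0 => hd (by rw [h0]; rfl)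
  have h' : a * d = 3 * b * d := by
    have := h
    rw [← mul_assoc] at this
    exact_mod_cast this
  exact_mod_cast Nat.eq_of_mul_eq_mul_right hd' h'

variable {S N N' : Type u} [CommRing S] [IsLocalRing S] [CommRing N] [CommRing N'] [Algebra N N']
  (𝔮 : Ideal N) [𝔮.IsMaximal] [IsLocalization.AtPrime N' 𝔮] [IsLocalRing N']
  (φ : S →+* N) (h𝔮 : 𝔮.comap φ = maximalIdeal S) {V : Scheme.{u}} (σ : V ⟶ Spec (.of N))

include h𝔮 in
omit [IsLocalRing N'] in
/-- `S → N → N_𝔮` is a local homomorphism when `𝔮` lies over `𝔪_S`. [folklore] -/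
theorem isLocalHom_comp_of_comap_eq : IsLocalHom ((algebraMap N N').comp φ) := by
  refine ⟨fun s hs => ?_⟩
  have hs' : IsUnit (algebraMap N N' (φ s)) := hs
  rw [IsLocalization.AtPrime.isUnit_to_map_iff N' 𝔮 (φ s)] at hs'
  by_contra hsu
  have hmem : s ∈ maximalIdeal S := hsu
  rw [← h𝔮] at hmem
  exact hs' hmem

include h𝔮 in
/-- **FIRST KIND IS INHERITED BY THE GERM RESOLUTION** (ring-hom form; no residue-field instance in the
statement). Let `S` be local, `φ : S → N`, `𝔮 ⊂ N` a maximal ideal over `𝔪_S` (`𝔮.comap φ = 𝔪_S`),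
`N' = N_𝔮`, `σ : V → Spec N`, `g = Spec(N → N')`, `ψ = pullback.snd σ g : V ×_N Spec N' → Spec N'` (the germ
resolution when `σ` is a resolution) and `ζ` a point of `V ×_N Spec N'` whose image `z = fst ζ` lies over `𝔮`.
If the integral curve `E_z = cl{z}` is OF THE FIRST KIND OVER `S`, `h0 (σ ≫ Spec φ) (𝓘_z ^ 2) = 3 * h0 (σ ≫ Spec φ) 𝓘_z`,
with `h0 (σ ≫ Spec φ) 𝓘_z` finite, then `E_ζ = cl{ζ}` is of the first kind over the germ:
`h0 ψ (𝓘_ζ ^ 2) = 3 * h0 ψ 𝓘_ζ` — the literal hypothesis of `Lipman1969_27_1_reg_rat` for `ψ`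
(`h0_comap_fst_localization_mul` twice, `comap_fst_primeDivisorIdeal(_pow)`, cancel `[κ(𝔮) : κ(𝔪_S)]`).
[this work] -/
theorem h0_primeDivisorIdeal_sq_eq_three_mul_of_fst
    (ζ : ↑(pullback σ (Spec.map (CommRingCat.ofHom (algebraMap N N')))))
    (hζ : σ.base ((pullback.fst σ (Spec.map (CommRingCat.ofHom (algebraMap N N')))).base ζ) =
      ⟨𝔮, inferInstance⟩)
    (hfk : h0 (σ ≫ Spec.map (CommRingCat.ofHom φ))
        (primeDivisorIdeal ((pullback.fst σ (Spec.map (CommRingCat.ofHom (algebraMap N N')))).base ζ) ^ 2) =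
      3 * h0 (σ ≫ Spec.map (CommRingCat.ofHom φ))
        (primeDivisorIdeal ((pullback.fst σ (Spec.map (CommRingCat.ofHom (algebraMap N N')))).base ζ)))
    (hfin : h0 (σ ≫ Spec.map (CommRingCat.ofHom φ))
        (primeDivisorIdeal ((pullback.fst σ (Spec.map (CommRingCat.ofHom (algebraMap N N')))).base ζ)) ≠ ⊤) :
    h0 (pullback.snd σ (Spec.map (CommRingCat.ofHom (algebraMap N N')))) (primeDivisorIdeal ζ ^ 2) =
      3 * h0 (pullback.snd σ (Spec.map (CommRingCat.ofHom (algebraMap N N')))) (primeDivisorIdeal ζ) := by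
  letI : Algebra S N := φ.toAlgebra
  letI : Algebra S N' := ((algebraMap N N').comp φ).toAlgebra
  haveI : IsScalarTower S N N' := IsScalarTower.of_algebraMap_eq fun _ => rfl
  haveI : IsLocalHom (algebraMap S N') := isLocalHom_comp_of_comap_eq 𝔮 φ h𝔮
  have hover : ∀ v ∈ (primeDivisorIdeal
      ((pullback.fst σ (Spec.map (CommRingCat.ofHom (algebraMap N N')))).base ζ)).support,
      σ.base v = ⟨𝔮, inferInstance⟩ := fun v hv =>
    base_eq_of_mem_support_primeDivisorIdeal 𝔮 σ hζ hv
  have hover2 : ∀ v ∈ (primeDivisorIdeal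
      ((pullback.fst σ (Spec.map (CommRingCat.ofHom (algebraMap N N')))).base ζ) ^ 2).support,
      σ.base v = ⟨𝔮, inferInstance⟩ := fun v hv => by
    rw [support_pow _ 2 two_ne_zero] at hv
    exact hover v hv
  have H1 := h0_comap_fst_localization_mul (S := S) (N' := N') 𝔮 σ _ hover
  have H2 := h0_comap_fst_localization_mul (S := S) (N' := N') 𝔮 σ _ hover2
  rw [comap_fst_primeDivisorIdeal 𝔮 σ ζ hζ] at H1
  rw [comap_fst_primeDivisorIdeal_pow 𝔮 σ ζ hζ] at H2
  -- `algebraMap S N = φ` by construction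
  change _ = h0 (σ ≫ Spec.map (CommRingCat.ofHom φ)) _ at H1
  change _ = h0 (σ ≫ Spec.map (CommRingCat.ofHom φ)) _ at H2
  have hd : Module.length (ResidueField S) (ResidueField N') ≠ 0 :=
    pos_iff_ne_zero.mp Module.length_pos
  refine enat_eq_three_mul hd (H1 ▸ hfin) ?_
  rw [H2, H1, hfk]

variable {X : Scheme.{u}} (π : X ⟶ Spec (.of S)) (U : X.Opens) (σU : ↑U ⟶ Spec (.of N))
  (hσU : σU ≫ Spec.map (CommRingCat.ofHom φ) = U.ι ≫ π)

include h𝔮 hσU in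
/-- **UP-5 feeds the germ** (open-immersion form). Let `π : X → Spec S` (`S` local; e.g. `π¹ = ρ ≫ π` on
`X¹ = Bl_{nodes} X`), `U ⊆ X` an open carrying `σ : U → Spec N` over `Spec S` (`σ ≫ Spec φ = U.ι ≫ π`; e.g. the
chart resolution), `𝔮`, `N'`, `g`, `ψ = pullback.snd σ g` as above, and `ζ ∈ U ×_N Spec N'` with `z = fst ζ`
over `𝔮` and the whole curve inside `U`: `cl_X{z} ⊆ U`. If `E = cl_X{z}` is of the first kind for `π`,
`h0 π (𝓘_E ^ 2) = 3 * h0 π 𝓘_E` with `h0 π 𝓘_E` finite (UP-5: `…PointBlowupNode.h0_comap_vanishingIdeal_node` with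
`…PointBlowupRegularPoint.exists_primeDivisorIdeal_eq_comap_vanishingIdeal`), then
`h0 ψ (𝓘_ζ ^ 2) = 3 * h0 ψ 𝓘_ζ` (`…PointBlowupNode.h0_comap_of_isOpenImmersion` + the germ step). [this work] -/
theorem h0_primeDivisorIdeal_sq_eq_three_mul_of_fst_of_openImmersion
    (ζ : ↑(pullback σU (Spec.map (CommRingCat.ofHom (algebraMap N N')))))
    (hζ : σU.base ((pullback.fst σU (Spec.map (CommRingCat.ofHom (algebraMap N N')))).base ζ) =
      ⟨𝔮, inferInstance⟩)
    (hcl : closure {U.ι.base ((pullback.fst σU (Spec.map (CommRingCat.ofHom (algebraMap N N')))).base ζ)} ⊆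
      (U : Set X))
    (hfk : h0 π (primeDivisorIdeal
        (U.ι.base ((pullback.fst σU (Spec.map (CommRingCat.ofHom (algebraMap N N')))).base ζ)) ^ 2) =
      3 * h0 π (primeDivisorIdeal
        (U.ι.base ((pullback.fst σU (Spec.map (CommRingCat.ofHom (algebraMap N N')))).base ζ))))
    (hfin : h0 π (primeDivisorIdeal
        (U.ι.base ((pullback.fst σU (Spec.map (CommRingCat.ofHom (algebraMap N N')))).base ζ))) ≠ ⊤) :
    h0 (pullback.snd σU (Spec.map (CommRingCat.ofHom (algebraMap N N')))) (primeDivisorIdeal ζ ^ 2) =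
      3 * h0 (pullback.snd σU (Spec.map (CommRingCat.ofHom (algebraMap N N')))) (primeDivisorIdeal ζ) := by
  -- the curve seen on `U`: `U.ι*𝓘_E = 𝓘_z`, and `h⁰` over `S` does not see the restriction to `U ⊇ E`
  have hsupp : ((primeDivisorIdeal (U.ι.base ((pullback.fst σU
      (Spec.map (CommRingCat.ofHom (algebraMap N N')))).base ζ))).support : Set X) ⊆
      Set.range U.ι.base := by
    rw [coe_support_primeDivisorIdeal, Scheme.Opens.range_ι]
    exact hcl
  have e1 := PointBlowup.h0_comap_of_isOpenImmersion π U.ι _ hsupp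
  have e2 := PointBlowup.h0_comap_of_isOpenImmersion π U.ι _
    (by rw [support_pow _ 2 two_ne_zero]; exact hsupp)
  rw [comap_pow, comap_primeDivisorIdeal_of_isOpenImmersion] at e2
  rw [comap_primeDivisorIdeal_of_isOpenImmersion] at e1
  rw [← e1, ← e2, ← hσU] at hfk
  rw [← e1, ← hσU] at hfin
  exact h0_primeDivisorIdeal_sq_eq_three_mul_of_fst 𝔮 φ h𝔮 σU ζ hζ hfk hfin

end FirstKind

end Summit.ResolutionOfSingularities.ResolutionOfSingularities.Theorems.NoZeno.ExcCount

end
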